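import Mathlib
import Literature.Geometry.Lorentzian.GiorgiKlainermanSzeftel2022.GRWTransformationAlgebra

/-!
# Giorgi–Klainerman–Szeftel, *Wave equations estimates and the nonlinear stability of slowly rotating Kerr black holes* — App. D.6 ledger: the Teukolsky equation for `A̲` in `□̇₂` form (proof of Lemma 5.3.3)

Sources, read side by side (the loci of both are given in every docstring):

* `[J]`  E. Giorgi, S. Klainerman, J. Szeftel, *Wave equations estimates and the nonlinear
  stability of slowly rotating Kerr black holes*, Pure Appl. Math. Q. **20** (2024), no. 7
  (doi:10.4310/pamq.241128023033) — Remark 5.3.2 (file p0198 L48–76), Lemma 5.3.3 (p0199 L12–38)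
  and Appendix D.6 "Proof of Lemma 5.3.3" (p0874 L80 – p0876 L44, displays (D.6.1), (D.6.2)); the
  quoted inputs Lemma 2.2.17 (conformal derivatives, p0105 L7–10), Definition 2.4.8 (complex
  notation `P = ρ + i*ρ`, `H = η + i*η`, `Z = ζ + i*ζ`, p0113 L29–48), Definition 2.4.13 (conformal
  complex derivatives, p0116 L89 – p0117 L40), Lemma 2.4.5 (p0111 L35–45), Lemma 2.4.6 with (2.4.4),
  (2.4.5) (p0112 L16–36), Lemma 4.2.1 (4) = (4.2.7) (p0161 L51–56), Corollary 4.7.9 / (4.7.13)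
  (p0183 L5–51).  **Locator convention (as in the siblings `TeukolskyAbarLedger`,
  `TeukolskyQfbLedger`): `[J]` pages are the FILE pages `p0NNN` of the materialised journal PDF
  (= printed folio + 1), `Lnn` the line of the text layer of that file.**  The text layer drops
  under-bars, over-bars and the placement of the `⁽ᶜ⁾` superscripts; every barred symbol below was
  read at glyph level (the `\underline`/`\overline` rules of the page content stream) on p0198,
  p0199, p0874, p0875, p0876.
* `[v1]` the same authors, arXiv:2205.14808 (v1), TeX source lines `l.N`, for the QUOTED INPUTS only:
  Lemma `lemma:definition-conformal-derivatives` l.4559–4568, Definition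
  `def:complexRicciandcurvaturecoefficients` l.5041–5055, the conformal complex derivatives
  l.5191–5214, Lemma `dot-hot-complex` l.4928–4937, Lemma `SIMPLIFICATION-ANGULAR` (`Leibniz-hot` =
  (2.4.4) l.4985, `Leib-eq-DDb` / `Leib-eq-DDb-DD-nab` = (2.4.5) l.4992–4993), `correct-commutator-1`
  = (4.2.7) l.7341–7346, Corollary `corollary-wave-complex` (second form = (4.7.13) = (D.6.1))
  l.8280–8295, and — for comparison only — the Teukolsky operator `𝓛(A)` of Proposition
  `TEUKOLSKY-PROPOSITION` l.8567–8583, of which the `L̲(A̲)` of `[J]` Remark 5.3.2 is the `e₃ ↔ e₄`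
  mirror.  **Remark 5.3.2, Lemma 5.3.3 and App. D.6 have NO counterpart in `[v1]`** (whose §5.3 states
  the Teukolsky equation for `A̲` only in the `Â̲`-form of `[J]` Proposition 5.3.1, and whose App. D.5 /
  D.6 are `[J]` D.5 / D.7): this module types a `[J]`-only passage; `[J]` §12.4 Step 1 (p0595) is where
  Lemma 5.3.3 is used.

## What is transcribed

App. D.6 starts from the operator `L̲(A̲)` of Remark 5.3.2,
`L̲(A̲) = −ᶜ∇₃ᶜ∇₄A̲ + ¼ ᶜ𝒟⊗̂(conj(ᶜ𝒟)·A̲) + (−½tr X̲ − 2conj tr X̲) ᶜ∇₄A̲ − ½tr X ᶜ∇₃A̲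
 + (4H̲ + H + H̄)·ᶜ∇A̲ + (−conj(tr X̲) tr X + 2P)A̲ + H̲⊗̂(H̄·A̲)` (for which the Teukolsky equation
reads `L̲(A̲) = Err[L̲(A̲)]`), writes the conformal derivatives of the signature-`(−2)` tensor `A̲` in
terms of the plain ones (`ᶜ∇₃A̲ = ∇₃A̲ + 4ω̲A̲`, `ᶜ∇₄A̲ = ∇₄A̲ − 4ωA̲`, `ᶜ∇A̲ = ∇A̲ − 2ζA̲`,
`ᶜ∇₃ᶜ∇₄A̲ = ∇₃ᶜ∇₄A̲ + 2ω̲ᶜ∇₄A̲`, `conj(ᶜ𝒟)·A̲ = conj𝒟·A̲ − 2Z̄·A̲`,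
`ᶜ𝒟⊗̂(conj(ᶜ𝒟)·A̲) = 𝒟⊗̂(conj(ᶜ𝒟)·A̲) − 2Z⊗̂(conj(ᶜ𝒟)·A̲)`), expands with the Leibniz formulas
(2.4.4), (2.4.5) and Lemma 2.4.5, obtaining the "plain" form of `L̲(A̲)` (p0875 L44–70); it then
rewrites Corollary 4.7.9 (= (D.6.1)) with the commutator (4.2.7) as (D.6.2),
`□̇₂ψ = −∇₃∇₄ψ + ¼𝒟⊗̂(conj𝒟·ψ) + (2ω̲ − ½tr X̲)∇₄ψ − ½tr X∇₃ψ + 2η·∇ψ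
 + (−¼tr X conj(tr X̲) − ¼tr X̲ conj(tr X) − 2P)ψ − 2iη̲∧η ψ + (Γ_b·Γ_g)·ψ`,
and subtracts ("We then deduce", p0876 L5–44), which gives Lemma 5.3.3:
`□̇₂A̲ = (2conj tr X̲ + 4ω̲)∇₄A̲ − 4ω∇₃A̲ − (4H̲ − 4ζ)·∇A̲ + VA̲ + Err` with the printed potential
`V = ¾tr X conj(tr X̲) − ¼tr X̲ conj(tr X) − 4P − 4ω(½tr X̲ + 2conj tr X̲) + 2ω̲tr X − 4∇₃ω − 8ω̲ω
 + 𝒟·Z̄ − 2Z·Z̄ + 2ζ·(4H̲ + 2η) − 4η̲·η + 2iη̲∧η`.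

## How it is typed (the scalar–module shadow of the siblings; nothing tensorial is derived)

* Scalars: an abstract field `K` (of characteristic zero where printed fractions must be cleared); `i` is an element
  (only `P = ρ + i*ρ`, `P̄ = ρ − i*ρ` are used, never `i² = −1`); `x = tr X`, `xc = conj(tr X)`,
  `xb = tr X̲`, `xbc = conj(tr X̲)`, `om = ω`, `omb = ω̲`, `p = P`, `pc = P̄`, `rh = ρ`, `srh = *ρ`;
  `∇₃` acts on scalars through `D3 : Derivation ℤ K K` (`D3 om = ∇₃ω`).  The one-form products that
  occur are scalars: `dot : M₁ →ₗ[K] M₁ →ₗ[K] K` (so `η̲·η = dot etab eta`, `Z·Z̄ = dot Z Zc`,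
  `ζ·(4H̲ + 2η) = dot ze (4H̲ + 2η)`), the two wedge products `ew = η̲∧η`, `ew' = η∧η̲` are opaque
  scalars related by the hypothesis `ew' = −ew` where needed, and `divZc = 𝒟·Z̄` is opaque.
* Tensors: `K`-modules `M₁` (complex horizontal one-forms: `H, H̄ =: Hc, H̲ =: Hu, Z, Z̄ =: Zc, ζ =: ze,
  η =: eta, η̲ =: etab`, and the one-forms `conj𝒟·A̲ =: DbA`, `conj(ᶜ𝒟)·A̲ =: cDbA`), `M₂` (`𝔰₂(ℂ)`:
  `A̲ =: A` and everything valued there) and `M₃` (the values of `∇A̲ =: gradA`, `ᶜ∇A̲ =: cgradA`,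
  `ζ⊗A̲`).  `⊗̂` is `hot : M₁ →ₗ[K] M₁ →ₗ[K] M₂`, the contraction `F·U` of a one-form with an
  `𝔰₂` tensor is `ctr : M₁ →ₗ[K] M₂ →ₗ[K] M₁`, `F·∇A̲ := ct F gradA` with `ct : M₁ →ₗ[K] M₃ →ₗ[K] M₂`,
  `ξ⊗U` is `tp : M₁ →ₗ[K] M₂ →ₗ[K] M₃` with the pointwise rule `F·(ξ⊗U) = (ξ·F)U` as the hypothesis
  `hct`; `∇₃`, `∇₄` on `M₂` are the sibling's `CovD D M₂` BY NAME (additive with the scalar Leibniz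
  rule); `𝒟⊗̂` is an additive map `Dhat : M₁ →+ M₂`; `(Z·conj𝒟)A̲ =: ZDbA`, `(Z̄·𝒟)A̲ =: ZcDA`,
  `□̇₂A̲ =: boxA`, `L̲(A̲) =: LA` are opaque elements.  Every quoted equation — the six conformal
  rewritings displayed in D.6, (2.4.4) for `F = Z`, the two lines of (2.4.5) for `F = Z`, the two
  instances of Lemma 2.4.5, the definition of `L̲(A̲)`, (4.7.13) and (4.2.7) with `ψ = U = A̲`, and
  the Teukolsky equation `L̲(A̲) = Err[L̲(A̲)]` — enters as a HYPOTHESIS exactly in its displayed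
  form, each schematic remainder (`(Γ_b·Γ_g)·ψ` of (4.7.13) =: `E1`, `(Γ_b·Γ_g)U` of (4.2.7) =: `E2`,
  `Err[L̲(A̲)]` =: `ErrL`) an opaque element carried through as an explicit summand — never absorbed,
  never assigned an order or a sign convention.  What the kernel certifies is exactly the displayed
  coefficient bookkeeping.

## Certified (0 sorry, 0 def; every theorem closes by `subst`/`rw`/`simp only`/`ring`/`module`/`linear_combination`)

* §0 `D6_dictionary`: Lemma 2.2.17 at `s = −2` (and at `s + 1 = −1` for `ᶜ∇₃` acting on `ᶜ∇₄A̲`)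
  gives the four rewritings displayed at p0874 L84 – p0875 L10; `D6_P_conj`: `−2P̄ − 4i*ρ = −2P`.
* §1 `D6_c3c4`: the display `ᶜ∇₃ᶜ∇₄A̲ = ∇₃∇₄A̲ − 4ω∇₃A̲ + 2ω̲∇₄A̲ + (−4∇₃ω − 8ω̲ω)A̲` (p0875 L5–13).
* §2 `D6_cDhot_lines12`, `D6_cDhot_line3`, `D6_ZcD`, `D6_cDhot_line4`: the four-line display
  `ᶜ𝒟⊗̂(conj(ᶜ𝒟)·A̲) = … = 𝒟⊗̂(conj𝒟·A̲) − 8Z̄·∇A̲ − 8Z·∇A̲ − 4(𝒟·Z̄)A̲ + 4Z⊗̂(Z̄·A̲)`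
  (p0875 L15–43), including the consequence `(Z̄·𝒟)A̲ = 2Z̄·∇A̲` of the two lines of (2.4.5).
* §3 `D6_L_plain`: the plain form of `L̲(A̲)` (p0875 L44–76) from Remark 5.3.2 and §§0–2.
* §4 `D6_wave_D62`: (D.6.2) from (4.7.13) = (D.6.1) and (4.2.7) (p0875 L77–123), the schematic term
  being `E1 + E2`.
* §5 `D6_deduce`, `D6_deduce_box`: the two equalities of "We then deduce" (p0876 L5–43; the second
  carries the kernel's remainder `−(E1 + E2)` where the text prints the schematic `+Γ_b·Γ_g·A̲`);
  `D6_lemma533`: Lemma 5.3.3 with `V` exactly as printed (p0199 L17–33) and `Err = Err[L̲(A̲)] + E1 + E2`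
  (the text: `Err = r⁻¹𝔡^{≤1}(Γ_b·B̲) + Γ_b·Γ_b·Γ_g`, p0199 L35–37); `D6_lemma533_end_to_end`: the same
  conclusion in ONE theorem from the primitive quoted hypotheses (no intermediate display re-entered).

## Print data found by the kernel / by collation (offered to the cell's census, not rulings)

None: every display of App. D.6, the operator of Remark 5.3.2 and the statement of Lemma 5.3.3 are
reproduced by the kernel with the printed coefficients (the potential `V` term by term, including
`¾ = 1 − ¼` for `tr X conj(tr X̲)` and `2i = 4i − 2i` for `η̲∧η`).  Reading notes (schematic, not
defects): the last display of D.6 writes the (4.7.13)/(4.2.7) remainders as `+Γ_b·Γ_g·A̲` on the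
`□̇₂A̲` side, and Lemma 5.3.3 lists `Err` without that product (it is absorbed in `Γ_b·Γ_b·Γ_g`); the
kernel keeps `E1 + E2` explicit.

## Not claimed

No tensorial statement, commutation formula, Leibniz formula, wave-operator decomposition or
Teukolsky equation is derived; the signature bookkeeping of Lemma 2.2.17 is quoted, not proved; the
decay classes `Γ_g, Γ_b`, the symbols `r⁻ᵏ𝔡^{≤j}` and every absorption of a term into them are outside
the model and are mentioned in docstrings only as the text's words.  Nothing here is a
hypothesis-fact of `[J]`; no `def … : Prop`.  This module is a typed reading aid for the cell's census
of `[J]` ch. 5 / App. D (the `[J]`-only M2 collar of §12.4), not progress on any summit.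
-/

namespace Literature.Geometry.Lorentzian.GiorgiKlainermanSzeftel2022.TeukolskyAbarWaveLedger

open Literature.Geometry.Lorentzian.GiorgiKlainermanSzeftel2022.GRWTransformationAlgebra

variable {K : Type*} [Field K]

/-! ## §0 The signature dictionary and the `P` conjugation -/

/-- `−2P̄ − 4i*ρ = −2P` for `P = ρ + i*ρ`, `P̄ = ρ − i*ρ` (the potential of (D.6.1) plus the
`4i(−*ρ)` of (4.2.7) gives the `−2P` of (D.6.2)).
[cite: GiorgiKlainermanSzeftel2024, Definition 2.4.8 p0113 L29–34, p0875 L94–121; GiorgiKlainermanSzeftel2022, l.5044] -/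
theorem D6_P_conj (i rh srh p pc : K) (hp : p = rh + i * srh) (hpc : pc = rh - i * srh) :
    -(2 * pc) + 4 * i * -srh = -(2 * p) := by
  subst hp hpc; ring

section AppD6

variable {M₁ M₂ M₃ : Type*} [AddCommGroup M₁] [Module K M₁] [AddCommGroup M₂] [Module K M₂]
  [AddCommGroup M₃] [Module K M₃]

/-- The dictionary "recalling the definition of conformal operators": Lemma 2.2.17
(`ᶜ∇₃f = ∇₃f − 2sω̲f` of signature `s − 1`, `ᶜ∇₄f = ∇₄f + 2sωf` of signature `s + 1`,
`ᶜ∇f = ∇f + sζ⊗f`) for the signature-`(−2)` tensor `A̲` gives the displayed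
`ᶜ∇₃A̲ = ∇₃A̲ + 4ω̲A̲`, `ᶜ∇₄A̲ = ∇₄A̲ − 4ωA̲`, `ᶜ∇A̲ = ∇A̲ − 2ζ⊗A̲`, and, `ᶜ∇₄A̲` having signature
`s + 1 = −1`, `ᶜ∇₃ᶜ∇₄A̲ = ∇₃ᶜ∇₄A̲ + 2ω̲ ᶜ∇₄A̲`.
[cite: GiorgiKlainermanSzeftel2024, Lemma 2.2.17 p0105 L7–10, p0874 L84–95, p0875 L5–10; GiorgiKlainermanSzeftel2022, l.4559–4568] -/
theorem D6_dictionary {D3 D4 : Derivation ℤ K K} (N3 : CovD D3 M₂) (N4 : CovD D4 M₂)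
    (tp : M₁ →ₗ[K] M₂ →ₗ[K] M₃) (s om omb : K) (ze : M₁) (A cN3A cN4A c3c4A : M₂)
    (gradA cgradA : M₃) (hs : s = -2)
    (hc3 : cN3A = N3.op A - (2 * s * omb) • A) (hc4 : cN4A = N4.op A + (2 * s * om) • A)
    (hcg : cgradA = gradA + s • tp ze A)
    (hc34 : c3c4A = N3.op cN4A - (2 * (s + 1) * omb) • cN4A) :
    cN3A = N3.op A + (4 * omb) • A ∧ cN4A = N4.op A - (4 * om) • A
      ∧ cgradA = gradA - (2 : K) • tp ze A ∧ c3c4A = N3.op cN4A + (2 * omb) • cN4A := by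
  subst hs hc3 hc4 hcg hc34
  refine ⟨by module, by module, by module, by module⟩

/-! ## §1 `ᶜ∇₃ᶜ∇₄A̲` -/

/-- "`ᶜ∇₃ᶜ∇₄A̲ = ∇₃ᶜ∇₄A̲ + 2ω̲ᶜ∇₄A̲ = ∇₃(∇₄A̲ − 4ωA̲) + 2ω̲(∇₄A̲ − 4ωA̲)
= ∇₃∇₄A̲ − 4ω∇₃A̲ + 2ω̲∇₄A̲ + (−4∇₃ω − 8ω̲ω)A̲`" (Leibniz rule of `∇₃` on `ωA̲`; `D3 om = ∇₃ω`).
[cite: GiorgiKlainermanSzeftel2024, p0875 L5–13; GiorgiKlainermanSzeftel2022, l.4559–4568] -/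
theorem D6_c3c4 {D3 D4 : Derivation ℤ K K} (N3 : CovD D3 M₂) (N4 : CovD D4 M₂) (om omb : K)
    (A cN4A c3c4A : M₂)
    (hc4 : cN4A = N4.op A - (4 * om) • A) (hc34 : c3c4A = N3.op cN4A + (2 * omb) • cN4A) :
    c3c4A = N3.op (N4.op A) - (4 * om) • N3.op A + (2 * omb) • N4.op A
      + (-(4 * D3 om) - 8 * omb * om) • A := by
  obtain ⟨-, -, h4, -, -⟩ := D_num D3
  subst hc4 hc34
  rw [map_sub, N3.leibniz]
  simp only [D3.leibniz, h4, smul_eq_mul, mul_zero, add_zero]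
  module

/-! ## §2 `ᶜ𝒟⊗̂(conj(ᶜ𝒟)·A̲)` -/

/-- Lines 1–2 of the display: with `conj(ᶜ𝒟)·A̲ = conj𝒟·A̲ − 2Z̄·A̲` (`hcDb`) and
`ᶜ𝒟⊗̂F = 𝒟⊗̂F − 2Z⊗̂F` on the signature-`(−2)` one-form `F = conj(ᶜ𝒟)·A̲` (`hcDhot`),
"`ᶜ𝒟⊗̂(conj(ᶜ𝒟)·A̲) = 𝒟⊗̂(conj𝒟·A̲ − 2Z̄·A̲) − 2Z⊗̂(conj𝒟·A̲ − 2Z̄·A̲)`", expanded (additivity of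
`𝒟⊗̂`, bilinearity of `⊗̂`).
[cite: GiorgiKlainermanSzeftel2024, p0875 L15–31, Definition 2.4.13 p0116 L89–p0117 L40; GiorgiKlainermanSzeftel2022, l.5191–5214, l.4559–4568] -/
theorem D6_cDhot_lines12 (hot : M₁ →ₗ[K] M₁ →ₗ[K] M₂) (Dhat : M₁ →+ M₂)
    (ctr : M₁ →ₗ[K] M₂ →ₗ[K] M₁) (Z Zc DbA cDbA : M₁) (A cDhot : M₂)
    (hcDb : cDbA = DbA - (2 : K) • ctr Zc A)
    (hcDhot : cDhot = Dhat cDbA - (2 : K) • hot Z cDbA) :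
    cDhot = Dhat DbA - (2 : K) • Dhat (ctr Zc A) - (2 : K) • hot Z DbA
      + (4 : K) • hot Z (ctr Zc A) := by
  subst hcDb hcDhot
  have h2 : Dhat ((2 : K) • ctr Zc A) = (2 : K) • Dhat (ctr Zc A) := by
    rw [two_smul, map_add, two_smul]
  rw [map_sub, h2]
  simp only [map_sub, map_smul]
  module

/-- Line 3: inserting (2.4.4) for `F = Z`, "`𝒟⊗̂(Z̄·A̲) = 2(𝒟·Z̄)A̲ + 2(Z̄·𝒟)A̲`" (`h244`; `divZc = 𝒟·Z̄`,
`ZcDA = (Z̄·𝒟)A̲`): "`= 𝒟⊗̂(conj𝒟·A̲) − 4(𝒟·Z̄)A̲ − 4(Z̄·𝒟)A̲ − 2Z⊗̂(conj𝒟·A̲) + 4Z⊗̂(Z̄·A̲)`".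
[cite: GiorgiKlainermanSzeftel2024, p0875 L32–41, (2.4.4) p0112 L24–27; GiorgiKlainermanSzeftel2022, l.4985] -/
theorem D6_cDhot_line3 (hot : M₁ →ₗ[K] M₁ →ₗ[K] M₂) (Dhat : M₁ →+ M₂)
    (ctr : M₁ →ₗ[K] M₂ →ₗ[K] M₁) (divZc : K) (Z Zc DbA : M₁) (A cDhot ZcDA : M₂)
    (h12 : cDhot = Dhat DbA - (2 : K) • Dhat (ctr Zc A) - (2 : K) • hot Z DbA
      + (4 : K) • hot Z (ctr Zc A))
    (h244 : Dhat (ctr Zc A) = (2 * divZc) • A + (2 : K) • ZcDA) :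
    cDhot = Dhat DbA - (4 * divZc) • A - (4 : K) • ZcDA - (2 : K) • hot Z DbA
      + (4 : K) • hot Z (ctr Zc A) := by
  subst h12
  rw [h244]
  module

/-- The step from line 3 to line 4 uses, besides the first line of (2.4.5)
("`Z⊗̂(conj𝒟·A̲) = 2(Z·conj𝒟)A̲ = 4Z·∇A̲`", `h245a`, `h245b`), the consequence
`(Z̄·𝒟)A̲ = 2Z̄·∇A̲` of its second line "`(F·conj𝒟)U + (F̄·𝒟)U = 2(F + F̄)·∇U`" (`h245c`).
[cite: GiorgiKlainermanSzeftel2024, (2.4.5) p0112 L31–36, p0875 L37–43; GiorgiKlainermanSzeftel2022, l.4992–4993] -/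
theorem D6_ZcD (ct : M₁ →ₗ[K] M₃ →ₗ[K] M₂) (Z Zc : M₁) (ZDbA ZcDA : M₂) (gradA : M₃)
    (h245b : ZDbA = (2 : K) • ct Z gradA) (h245c : ZDbA + ZcDA = (2 : K) • ct (Z + Zc) gradA) :
    ZcDA = (2 : K) • ct Zc gradA := by
  subst h245b
  simp only [map_add, LinearMap.add_apply, smul_add] at h245c
  linear_combination (norm := module) h245c

/-- Line 4: "`ᶜ𝒟⊗̂(conj(ᶜ𝒟)·A̲) = 𝒟⊗̂(conj𝒟·A̲) − 8Z̄·∇A̲ − 8Z·∇A̲ − 4(𝒟·Z̄)A̲ + 4Z⊗̂(Z̄·A̲)`"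
(`F·∇A̲ = ct F gradA`).
[cite: GiorgiKlainermanSzeftel2024, p0875 L36–43, (2.4.5) p0112 L31–36; GiorgiKlainermanSzeftel2022, l.4992–4993] -/
theorem D6_cDhot_line4 (hot : M₁ →ₗ[K] M₁ →ₗ[K] M₂) (Dhat : M₁ →+ M₂)
    (ctr : M₁ →ₗ[K] M₂ →ₗ[K] M₁) (ct : M₁ →ₗ[K] M₃ →ₗ[K] M₂) (divZc : K) (Z Zc DbA : M₁)
    (A cDhot ZDbA ZcDA : M₂) (gradA : M₃)
    (h3 : cDhot = Dhat DbA - (4 * divZc) • A - (4 : K) • ZcDA - (2 : K) • hot Z DbA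
      + (4 : K) • hot Z (ctr Zc A))
    (h245a : hot Z DbA = (2 : K) • ZDbA) (h245b : ZDbA = (2 : K) • ct Z gradA)
    (hZcD : ZcDA = (2 : K) • ct Zc gradA) :
    cDhot = Dhat DbA - (8 : K) • ct Zc gradA - (8 : K) • ct Z gradA - (4 * divZc) • A
      + (4 : K) • hot Z (ctr Zc A) := by
  subst h3 hZcD
  rw [h245a, h245b]
  module

/-! ## §3 The plain form of `L̲(A̲)` -/

/-- "Therefore `L̲(A̲) = −∇₃∇₄A̲ + ¼𝒟⊗̂(conj𝒟·A̲) − (½tr X̲ + 2conj tr X̲ + 2ω̲)∇₄A̲ − (½tr X − 4ω)∇₃A̲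
+ (4H̲ + 2η − 4ζ)·∇A̲ + (−conj(tr X̲)tr X + 2P + 4ω(½tr X̲ + 2conj tr X̲) − 2ω̲tr X + 4∇₃ω + 8ω̲ω
− 𝒟·Z̄ + 2Z·Z̄ − 2ζ·(4H̲ + 2η) + 4(η̲·η − iη̲∧η))A̲`, where we used Lemma 2.4.5 to write
`H̲⊗̂(H̄·A̲) = 4(η̲·η − iη̲∧η)A̲` and `Z⊗̂(Z̄·A̲) = 2(Z·Z̄)A̲`."  Inputs: the operator of Remark 5.3.2
(`hL`), §0 (`hc3`, `hc4`, `hcg`), §1 in expanded form (`hc34`), §2 line 4 (`hcD`), `H + H̄ = 2η`,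
`Z + Z̄ = 2ζ` (Definition 2.4.8), the two instances of Lemma 2.4.5 (`hHH`, `hZZ`; `ew = η̲∧η`) and the
pointwise rule `F·(ζ⊗A̲) = (ζ·F)A̲` (`hct`).
[cite: GiorgiKlainermanSzeftel2024, Remark 5.3.2 p0198 L48–76, p0875 L44–76, Lemma 2.4.5 p0111 L35–45, Definition 2.4.8 p0113 L29–48; GiorgiKlainermanSzeftel2022, l.4928–4937, l.5041–5055] -/
theorem D6_L_plain [CharZero K] {D3 D4 : Derivation ℤ K K} (N3 : CovD D3 M₂) (N4 : CovD D4 M₂)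
    (hot : M₁ →ₗ[K] M₁ →ₗ[K] M₂) (Dhat : M₁ →+ M₂) (ctr : M₁ →ₗ[K] M₂ →ₗ[K] M₁)
    (ct : M₁ →ₗ[K] M₃ →ₗ[K] M₂) (tp : M₁ →ₗ[K] M₂ →ₗ[K] M₃) (dot : M₁ →ₗ[K] M₁ →ₗ[K] K)
    (i x xb xbc om omb p divZc ew : K) (H Hc Hu Z Zc ze eta etab DbA : M₁)
    (A cN3A cN4A c3c4A cDhot LA : M₂) (gradA cgradA : M₃)
    (hL : LA = -c3c4A + (1 / 4 : K) • cDhot + (-(1 / 2 * xb) - 2 * xbc) • cN4A - (1 / 2 * x) • cN3A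
      + ct ((4 : K) • Hu + H + Hc) cgradA + (-(xbc * x) + 2 * p) • A + hot Hu (ctr Hc A))
    (hc3 : cN3A = N3.op A + (4 * omb) • A) (hc4 : cN4A = N4.op A - (4 * om) • A)
    (hcg : cgradA = gradA - (2 : K) • tp ze A)
    (hc34 : c3c4A = N3.op (N4.op A) - (4 * om) • N3.op A + (2 * omb) • N4.op A
      + (-(4 * D3 om) - 8 * omb * om) • A)
    (hcD : cDhot = Dhat DbA - (8 : K) • ct Zc gradA - (8 : K) • ct Z gradA - (4 * divZc) • A
      + (4 : K) • hot Z (ctr Zc A))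
    (hHc : H + Hc = (2 : K) • eta) (hZc : Z + Zc = (2 : K) • ze)
    (hHH : hot Hu (ctr Hc A) = (4 * (dot etab eta - i * ew)) • A)
    (hZZ : hot Z (ctr Zc A) = (2 * dot Z Zc) • A)
    (hct : ∀ F : M₁, ct F (tp ze A) = dot ze F • A) :
    LA = -N3.op (N4.op A) + (1 / 4 : K) • Dhat DbA
      - (1 / 2 * xb + 2 * xbc + 2 * omb) • N4.op A - (1 / 2 * x - 4 * om) • N3.op A
      + ct ((4 : K) • Hu + (2 : K) • eta - (4 : K) • ze) gradA
      + (-(xbc * x) + 2 * p + 4 * om * (1 / 2 * xb + 2 * xbc) - 2 * omb * x + 4 * D3 om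
          + 8 * omb * om - divZc + 2 * dot Z Zc - 2 * dot ze ((4 : K) • Hu + (2 : K) • eta)
          + 4 * (dot etab eta - i * ew)) • A := by
  have hHc' : Hc = (2 : K) • eta - H := eq_sub_of_add_eq' hHc
  have hZc' : Zc = (2 : K) • ze - Z := eq_sub_of_add_eq' hZc
  subst hL hc3 hc4 hcg hc34 hcD
  rw [hHH, hZZ]
  subst hHc' hZc'
  simp only [map_add, map_sub, map_smul, LinearMap.add_apply, LinearMap.sub_apply,
    LinearMap.smul_apply, hct]
  module

/-! ## §4 (D.6.1) and (D.6.2) -/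

/-- From Corollary 4.7.9 in the form (4.7.13) = (D.6.1) for `ψ = A̲`,
"`□̇₂ψ = −∇₄∇₃ψ + ¼𝒟⊗̂(conj𝒟·ψ) + (2ω − ½tr X)∇₃ψ − ½tr X̲∇₄ψ + 2η̲·∇ψ
+ (−¼tr X conj(tr X̲) − ¼tr X̲ conj(tr X) − 2P̄)ψ − 2iη∧η̲ψ + (Γ_b·Γ_g)·ψ`" (`h61`, remainder `E1`,
`ew' = η∧η̲`), and (4.2.7) for `U = A̲`, "`[∇₃, ∇₄]U = −2ω∇₃U + 2ω̲∇₄U + 2(η − η̲)·∇U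
+ 4i(−*ρ + η∧η̲)U + (Γ_b·Γ_g)U`" (`h427`, remainder `E2`), with `P = ρ + i*ρ`, `P̄ = ρ − i*ρ` and
`η∧η̲ = −η̲∧η`: "we deduce (D.6.2) `□̇₂ψ = −∇₃∇₄ψ + ¼𝒟⊗̂(conj𝒟·ψ) + (2ω̲ − ½tr X̲)∇₄ψ − ½tr X∇₃ψ
+ 2η·∇ψ + (−¼tr X conj(tr X̲) − ¼tr X̲ conj(tr X) − 2P)ψ − 2iη̲∧ηψ + (Γ_b·Γ_g)·ψ`", the schematic
term being the kernel's `E1 + E2`.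
[cite: GiorgiKlainermanSzeftel2024, (D.6.1) (D.6.2) p0875 L77–123, Corollary 4.7.9 p0183 L5–51, (4.2.7) p0161 L51–56; GiorgiKlainermanSzeftel2022, l.8280–8295, l.7341–7346] -/
theorem D6_wave_D62 {D3 D4 : Derivation ℤ K K} (N3 : CovD D3 M₂) (N4 : CovD D4 M₂)
    (Dhat : M₁ →+ M₂) (ct : M₁ →ₗ[K] M₃ →ₗ[K] M₂)
    (i x xc xb xbc om omb p pc rh srh ew ew' : K) (eta etab DbA : M₁) (A boxA E1 E2 : M₂)
    (gradA : M₃)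
    (h61 : boxA = -N4.op (N3.op A) + (1 / 4 : K) • Dhat DbA + (2 * om - 1 / 2 * x) • N3.op A
      - (1 / 2 * xb) • N4.op A + (2 : K) • ct etab gradA
      + (-(1 / 4 * x * xbc) - 1 / 4 * xb * xc - 2 * pc) • A - (2 * i * ew') • A + E1)
    (h427 : N3.op (N4.op A) - N4.op (N3.op A) = -((2 * om) • N3.op A) + (2 * omb) • N4.op A
      + (2 : K) • ct (eta - etab) gradA + (4 * i * (-srh + ew')) • A + E2)
    (hp : p = rh + i * srh) (hpc : pc = rh - i * srh) (hew : ew' = -ew) :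
    boxA = -N3.op (N4.op A) + (1 / 4 : K) • Dhat DbA + (2 * omb - 1 / 2 * xb) • N4.op A
      - (1 / 2 * x) • N3.op A + (2 : K) • ct eta gradA
      + (-(1 / 4 * x * xbc) - 1 / 4 * xb * xc - 2 * p) • A - (2 * i * ew) • A + (E1 + E2) := by
  subst h61 hp hpc hew
  simp only [map_sub, LinearMap.sub_apply] at h427 ⊢
  linear_combination (norm := module) h427

/-! ## §5 "We then deduce" and Lemma 5.3.3 -/

/-- First equality of the final display: the plain form of `L̲(A̲)` (`hL`, as certified in §3)
regrouped around the right-hand side of (D.6.2),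
"`L̲(A̲) = −∇₃∇₄A̲ + ¼𝒟⊗̂(conj𝒟·A̲) + (2ω̲ − ½tr X̲)∇₄A̲ − ½tr X∇₃A̲ + 2η·∇A̲
− (2conj tr X̲ + 4ω̲)∇₄A̲ + 4ω∇₃A̲ + (4H̲ − 4ζ)·∇A̲ + (−conj(tr X̲)tr X + 2P + 4ω(½tr X̲ + 2conj tr X̲)
− 2ω̲tr X + 4∇₃ω + 8ω̲ω − 𝒟·Z̄ + 2Z·Z̄ − 2ζ·(4H̲ + 2η) + 4(η̲·η − iη̲∧η))A̲`".
[cite: GiorgiKlainermanSzeftel2024, p0876 L5–27] -/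
theorem D6_deduce {D3 D4 : Derivation ℤ K K} (N3 : CovD D3 M₂) (N4 : CovD D4 M₂)
    (Dhat : M₁ →+ M₂) (ct : M₁ →ₗ[K] M₃ →ₗ[K] M₂) (dot : M₁ →ₗ[K] M₁ →ₗ[K] K)
    (i x xb xbc om omb p divZc d3om ew : K) (Hu Z Zc ze eta etab DbA : M₁) (A LA : M₂)
    (gradA : M₃)
    (hL : LA = -N3.op (N4.op A) + (1 / 4 : K) • Dhat DbA
      - (1 / 2 * xb + 2 * xbc + 2 * omb) • N4.op A - (1 / 2 * x - 4 * om) • N3.op A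
      + ct ((4 : K) • Hu + (2 : K) • eta - (4 : K) • ze) gradA
      + (-(xbc * x) + 2 * p + 4 * om * (1 / 2 * xb + 2 * xbc) - 2 * omb * x + 4 * d3om
          + 8 * omb * om - divZc + 2 * dot Z Zc - 2 * dot ze ((4 : K) • Hu + (2 : K) • eta)
          + 4 * (dot etab eta - i * ew)) • A) :
    LA = (-N3.op (N4.op A) + (1 / 4 : K) • Dhat DbA + (2 * omb - 1 / 2 * xb) • N4.op A
        - (1 / 2 * x) • N3.op A + (2 : K) • ct eta gradA)
      - (2 * xbc + 4 * omb) • N4.op A + (4 * om) • N3.op A + ct ((4 : K) • Hu - (4 : K) • ze) gradA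
      + (-(xbc * x) + 2 * p + 4 * om * (1 / 2 * xb + 2 * xbc) - 2 * omb * x + 4 * d3om
          + 8 * omb * om - divZc + 2 * dot Z Zc - 2 * dot ze ((4 : K) • Hu + (2 : K) • eta)
          + 4 * (dot etab eta - i * ew)) • A := by
  subst hL
  simp only [map_add, map_sub, map_smul, LinearMap.add_apply, LinearMap.sub_apply,
    LinearMap.smul_apply]
  module

/-- Second equality of the final display: with (D.6.2) for `ψ = A̲` (`h62`, schematic term `E1 + E2`),
"`L̲(A̲) = □̇₂A̲ − (2conj tr X̲ + 4ω̲)∇₄A̲ + 4ω∇₃A̲ + (4H̲ − 4ζ)·∇A̲ + (−¾tr X conj(tr X̲)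
+ ¼tr X̲ conj(tr X) + 4P + 4ω(½tr X̲ + 2conj tr X̲) − 2ω̲tr X + 4∇₃ω + 8ω̲ω − 𝒟·Z̄ + 2Z·Z̄
− 2ζ·(4H̲ + 2η) + 4η̲·η − 2iη̲∧η)A̲ + Γ_b·Γ_g·A̲`" — the kernel's last summand is `−(E1 + E2)`
(the text's `+Γ_b·Γ_g·A̲` is schematic).
[cite: GiorgiKlainermanSzeftel2024, p0876 L29–44] -/
theorem D6_deduce_box [CharZero K] {D3 D4 : Derivation ℤ K K} (N3 : CovD D3 M₂) (N4 : CovD D4 M₂)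
    (Dhat : M₁ →+ M₂) (ct : M₁ →ₗ[K] M₃ →ₗ[K] M₂) (dot : M₁ →ₗ[K] M₁ →ₗ[K] K)
    (i x xc xb xbc om omb p divZc d3om ew : K) (Hu Z Zc ze eta etab DbA : M₁)
    (A LA boxA E1 E2 : M₂) (gradA : M₃)
    (hL : LA = -N3.op (N4.op A) + (1 / 4 : K) • Dhat DbA
      - (1 / 2 * xb + 2 * xbc + 2 * omb) • N4.op A - (1 / 2 * x - 4 * om) • N3.op A
      + ct ((4 : K) • Hu + (2 : K) • eta - (4 : K) • ze) gradA
      + (-(xbc * x) + 2 * p + 4 * om * (1 / 2 * xb + 2 * xbc) - 2 * omb * x + 4 * d3om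
          + 8 * omb * om - divZc + 2 * dot Z Zc - 2 * dot ze ((4 : K) • Hu + (2 : K) • eta)
          + 4 * (dot etab eta - i * ew)) • A)
    (h62 : boxA = -N3.op (N4.op A) + (1 / 4 : K) • Dhat DbA + (2 * omb - 1 / 2 * xb) • N4.op A
      - (1 / 2 * x) • N3.op A + (2 : K) • ct eta gradA
      + (-(1 / 4 * x * xbc) - 1 / 4 * xb * xc - 2 * p) • A - (2 * i * ew) • A + (E1 + E2)) :
    LA = boxA - (2 * xbc + 4 * omb) • N4.op A + (4 * om) • N3.op A
      + ct ((4 : K) • Hu - (4 : K) • ze) gradA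
      + (-(3 / 4 * x * xbc) + 1 / 4 * xb * xc + 4 * p + 4 * om * (1 / 2 * xb + 2 * xbc)
          - 2 * omb * x + 4 * d3om + 8 * omb * om - divZc + 2 * dot Z Zc
          - 2 * dot ze ((4 : K) • Hu + (2 : K) • eta) + 4 * dot etab eta - 2 * i * ew) • A
      - (E1 + E2) := by
  subst hL h62
  simp only [map_add, map_sub, map_smul, LinearMap.add_apply, LinearMap.sub_apply,
    LinearMap.smul_apply]
  module

/-- **Lemma 5.3.3** ("which gives the desired identity"): from the second equality of the final
display (`hfin`, as certified in `D6_deduce_box`) and the Teukolsky equation `L̲(A̲) = Err[L̲(A̲)]`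
of Remark 5.3.2 (`hT`, `ErrL = Err[L̲(A̲)]`),
"`□̇₂A̲ = (2conj tr X̲ + 4ω̲)∇₄A̲ − 4ω∇₃A̲ − (4H̲ − 4ζ)·∇A̲ + VA̲ + Err`, where
`V = ¾tr X conj(tr X̲) − ¼tr X̲ conj(tr X) − 4P − 4ω(½tr X̲ + 2conj tr X̲) + 2ω̲tr X − 4∇₃ω − 8ω̲ω
+ 𝒟·Z̄ − 2Z·Z̄ + 2ζ·(4H̲ + 2η) − 4η̲·η + 2iη̲∧η`" (`hV`, exactly as printed), with the kernel's
`Err = Err[L̲(A̲)] + E1 + E2` (the text: "`Err = r⁻¹𝔡^{≤1}(Γ_b·B̲) + Γ_b·Γ_b·Γ_g`").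
[cite: GiorgiKlainermanSzeftel2024, Lemma 5.3.3 p0199 L12–38, Remark 5.3.2 p0198 L48–50, p0876 L29–44] -/
theorem D6_lemma533 {D3 D4 : Derivation ℤ K K} (N3 : CovD D3 M₂) (N4 : CovD D4 M₂)
    (ct : M₁ →ₗ[K] M₃ →ₗ[K] M₂) (dot : M₁ →ₗ[K] M₁ →ₗ[K] K)
    (i x xc xb xbc om omb p divZc d3om ew V : K) (Hu Z Zc ze eta etab : M₁)
    (A LA boxA ErrL E1 E2 : M₂) (gradA : M₃)
    (hfin : LA = boxA - (2 * xbc + 4 * omb) • N4.op A + (4 * om) • N3.op A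
      + ct ((4 : K) • Hu - (4 : K) • ze) gradA
      + (-(3 / 4 * x * xbc) + 1 / 4 * xb * xc + 4 * p + 4 * om * (1 / 2 * xb + 2 * xbc)
          - 2 * omb * x + 4 * d3om + 8 * omb * om - divZc + 2 * dot Z Zc
          - 2 * dot ze ((4 : K) • Hu + (2 : K) • eta) + 4 * dot etab eta - 2 * i * ew) • A
      - (E1 + E2))
    (hT : LA = ErrL)
    (hV : V = 3 / 4 * x * xbc - 1 / 4 * xb * xc - 4 * p - 4 * om * (1 / 2 * xb + 2 * xbc)
      + 2 * omb * x - 4 * d3om - 8 * omb * om + divZc - 2 * dot Z Zc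
      + 2 * dot ze ((4 : K) • Hu + (2 : K) • eta) - 4 * dot etab eta + 2 * i * ew) :
    boxA = (2 * xbc + 4 * omb) • N4.op A - (4 * om) • N3.op A - ct ((4 : K) • Hu - (4 : K) • ze) gradA
      + V • A + (ErrL + E1 + E2) := by
  subst hV hT
  linear_combination (norm := module) -hfin

/-- **Lemma 5.3.3, end to end**: the same conclusion from the primitive quoted inputs alone —
Remark 5.3.2's operator (`hL`) and Teukolsky equation (`hT`), the conformal dictionary of
Lemma 2.2.17 / Definition 2.4.13 at signature `−2` as displayed in D.6 (`hc3`, `hc4`, `hcg`, `hc34`,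
`hcDb`, `hcDhot`), (2.4.4) and the two lines of (2.4.5) for `F = Z` (`h244`, `h245a`, `h245b`,
`h245c`), Lemma 2.4.5 for `(H̲, H)` and `(Z, Z)` (`hHH`, `hZZ`), Definition 2.4.8 (`hHc`, `hZc`, `hp`,
`hpc`), the pointwise rule `F·(ζ⊗A̲) = (ζ·F)A̲` (`hct`), (4.7.13) = (D.6.1) (`h61`) and (4.2.7)
(`h427`) for `ψ = U = A̲`, and `η∧η̲ = −η̲∧η` (`hew`).  No intermediate display is re-entered; the
potential is the printed `V` of Lemma 5.3.3 written out.
[cite: GiorgiKlainermanSzeftel2024, Lemma 5.3.3 p0199 L12–38, Remark 5.3.2 p0198 L48–76, App. D.6 p0874 L80–p0876 L44, Lemma 2.2.17 p0105 L7–10, Lemma 2.4.5 p0111 L35–45, (2.4.4) (2.4.5) p0112 L16–36, Definition 2.4.8 p0113 L29–48, (4.2.7) p0161 L51–56, Corollary 4.7.9 p0183 L5–51; GiorgiKlainermanSzeftel2022, l.4559–4568, l.4928–4937, l.4985–4993, l.5041–5055, l.5191–5214, l.7341–7346, l.8280–8295] -/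
theorem D6_lemma533_end_to_end [CharZero K] {D3 D4 : Derivation ℤ K K} (N3 : CovD D3 M₂) (N4 : CovD D4 M₂)
    (hot : M₁ →ₗ[K] M₁ →ₗ[K] M₂) (Dhat : M₁ →+ M₂) (ctr : M₁ →ₗ[K] M₂ →ₗ[K] M₁)
    (ct : M₁ →ₗ[K] M₃ →ₗ[K] M₂) (tp : M₁ →ₗ[K] M₂ →ₗ[K] M₃) (dot : M₁ →ₗ[K] M₁ →ₗ[K] K)
    (i x xc xb xbc om omb p pc rh srh divZc ew ew' : K)
    (H Hc Hu Z Zc ze eta etab DbA cDbA : M₁)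
    (A cN3A cN4A c3c4A cDhot ZDbA ZcDA LA boxA ErrL E1 E2 : M₂) (gradA cgradA : M₃)
    (hL : LA = -c3c4A + (1 / 4 : K) • cDhot + (-(1 / 2 * xb) - 2 * xbc) • cN4A - (1 / 2 * x) • cN3A
      + ct ((4 : K) • Hu + H + Hc) cgradA + (-(xbc * x) + 2 * p) • A + hot Hu (ctr Hc A))
    (hT : LA = ErrL)
    (hc3 : cN3A = N3.op A + (4 * omb) • A) (hc4 : cN4A = N4.op A - (4 * om) • A)
    (hcg : cgradA = gradA - (2 : K) • tp ze A)
    (hc34 : c3c4A = N3.op cN4A + (2 * omb) • cN4A)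
    (hcDb : cDbA = DbA - (2 : K) • ctr Zc A)
    (hcDhot : cDhot = Dhat cDbA - (2 : K) • hot Z cDbA)
    (h244 : Dhat (ctr Zc A) = (2 * divZc) • A + (2 : K) • ZcDA)
    (h245a : hot Z DbA = (2 : K) • ZDbA) (h245b : ZDbA = (2 : K) • ct Z gradA)
    (h245c : ZDbA + ZcDA = (2 : K) • ct (Z + Zc) gradA)
    (hHH : hot Hu (ctr Hc A) = (4 * (dot etab eta - i * ew)) • A)
    (hZZ : hot Z (ctr Zc A) = (2 * dot Z Zc) • A)
    (hHc : H + Hc = (2 : K) • eta) (hZc : Z + Zc = (2 : K) • ze)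
    (hp : p = rh + i * srh) (hpc : pc = rh - i * srh)
    (hct : ∀ F : M₁, ct F (tp ze A) = dot ze F • A)
    (h61 : boxA = -N4.op (N3.op A) + (1 / 4 : K) • Dhat DbA + (2 * om - 1 / 2 * x) • N3.op A
      - (1 / 2 * xb) • N4.op A + (2 : K) • ct etab gradA
      + (-(1 / 4 * x * xbc) - 1 / 4 * xb * xc - 2 * pc) • A - (2 * i * ew') • A + E1)
    (h427 : N3.op (N4.op A) - N4.op (N3.op A) = -((2 * om) • N3.op A) + (2 * omb) • N4.op A
      + (2 : K) • ct (eta - etab) gradA + (4 * i * (-srh + ew')) • A + E2)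
    (hew : ew' = -ew) :
    boxA = (2 * xbc + 4 * omb) • N4.op A - (4 * om) • N3.op A - ct ((4 : K) • Hu - (4 : K) • ze) gradA
      + (3 / 4 * x * xbc - 1 / 4 * xb * xc - 4 * p - 4 * om * (1 / 2 * xb + 2 * xbc)
          + 2 * omb * x - 4 * D3 om - 8 * omb * om + divZc - 2 * dot Z Zc
          + 2 * dot ze ((4 : K) • Hu + (2 : K) • eta) - 4 * dot etab eta + 2 * i * ew) • A
      + (ErrL + E1 + E2) := by
  -- §1 and §2 in expanded form
  have hc34x := D6_c3c4 N3 N4 om omb A cN4A c3c4A hc4 hc34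
  have h12 := D6_cDhot_lines12 hot Dhat ctr Z Zc DbA cDbA A cDhot hcDb hcDhot
  have h3 := D6_cDhot_line3 hot Dhat ctr divZc Z Zc DbA A cDhot ZcDA h12 h244
  have hZcD := D6_ZcD ct Z Zc ZDbA ZcDA gradA h245b h245c
  have hcD := D6_cDhot_line4 hot Dhat ctr ct divZc Z Zc DbA A cDhot ZDbA ZcDA gradA h3 h245a h245b hZcD
  -- §3: the plain form of `L̲(A̲)`
  have hplain := D6_L_plain N3 N4 hot Dhat ctr ct tp dot i x xb xbc om omb p divZc ew H Hc Hu Z Zc ze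
    eta etab DbA A cN3A cN4A c3c4A cDhot LA gradA cgradA hL hc3 hc4 hcg hc34x hcD hHc hZc hHH hZZ hct
  -- §4: (D.6.2)
  have h62 := D6_wave_D62 N3 N4 Dhat ct i x xc xb xbc om omb p pc rh srh ew ew' eta etab DbA A boxA
    E1 E2 gradA h61 h427 hp hpc hew
  -- §5
  have hfin := D6_deduce_box N3 N4 Dhat ct dot i x xc xb xbc om omb p divZc (D3 om) ew Hu Z Zc ze eta
    etab DbA A LA boxA E1 E2 gradA hplain h62
  exact D6_lemma533 N3 N4 ct dot i x xc xb xbc om omb p divZc (D3 om) ew _ Hu Z Zc ze eta etab A LA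
    boxA ErrL E1 E2 gradA hfin hT rfl

end AppD6

end Literature.Geometry.Lorentzian.GiorgiKlainermanSzeftel2022.TeukolskyAbarWaveLedger
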